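import Summits.Ventures.GridStability.Models.InverterMatchingDQ

/-!
# GridStability/Models/InverterMatchingFrames — the nominal-frame matching model of JouiniSun2022 §2.1 (`InverterVSM.Matching`) IS the dq-frame model of Arghir–Jouini–Dörfler 2018 (10a)–(10c) (`MatchingDQ`) after the rotation by the virtual angle `γ`

Cell `gridfusion` (rung G3; seat gridfusion-model-3 (g8); next-wave plumbing for #100-cand, ref-3 row 64 W1 «not derived
from the tree's αβ model»). The tree holds TWO typings of the matching-controlled converter: `InverterVSM.Matching`
(p459509; [cite: JouiniSun2022] §2.1: states `(γ, v_dc, i, v)` in a frame rotating at the NOMINAL frequency `ω*`, angle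
`γ` with `γ̇ = η (v_dc − v_dc*)`, modulation `r(γ) = (−sin γ, cos γ)`, rotation terms `L ω* J i`, `C ω* J v`) and
`MatchingDQ` (p538141; [cite: ArghirJouiniDorfler2018] (10a)–(10c): the converter's OWN dq-frame, angle-free, rotation
terms `η v_dc L J i_dq`, `η v_dc C J v_dq`, modulation `(μ/2) e₂`). This file proves the change of frame
`i_dq = R(γ)ᵀ i`, `v_dq = R(γ)ᵀ v` (`R(γ)ᵀ = [[cos γ, sin γ], [−sin γ, cos γ]]`, [cite: ArghirJouiniDorfler2018, (2)])
maps every solution of the first onto a solution of the second WITH THE LOAD PORT OPEN (`ĩ_l = R(γ)ᵀ i_net`), under the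
MATCHING RELATION `ω* = η v_dc*` ([cite: ArghirJouiniDorfler2018, (6b)]: «`η = ω₀/v_dc,ref`»), with the dictionary
`G_dc ↦ K_p` (JouiniSun's `K_p = G_dc + K̂_p`), `i_dc ↦ i*_dc + K_p v_dc*`, `G ↦ G`, `B_l = 0`, `s = 0`.

WHAT IS CERTIFIED (kernel; std axioms; 0 kit): `Matching.hasDerivAt_dqState` — for every `C¹` curve satisfying the six
printed component equations of `InverterVSM.Matching` (any input `i_net(t)`), each of the five dq components has the
derivative prescribed by `MatchingDQ.fieldPort` of `Matching.toDQ` with port input `(0, R(γ)ᵀ i_net)`; hence every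
closed-port / passivity / decay statement of `Models/InverterMatchingDQ.lean` reads on JouiniSun's typed model (e.g.
Thm. 3's identity via `hasDerivWithinAt_storage_port`). Pure calculus (product/chain rules, `sin² + cos² = 1`).
THREE COLUMNS: an identity between two MODELS; nothing about any device. MODELLED: both prints' averaged one-unit models.
-/

noncomputable section

open Real

namespace Summit.Ventures.GridStability.Models.InverterVSM.Matching

variable (K : Matching)

/-- The dq-frame record of a nominal-frame matching model: `G_dc ↦ K_p`, `i_dc ↦ i*_dc + K_p v_dc*`, `B_l = 0`, `s = 0`,
same `C_dc, L, R, C, G, η, μ`. [cite: ArghirJouiniDorfler2018, (10), (15)] [cite: JouiniSun2022, §2.1] -/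
def toDQ : MatchingDQ where
  Cdc := K.Cdc
  Gdc := K.Kp
  idc := K.idcRef + K.Kp * K.vdcRef
  L := K.L
  R := K.R
  C := K.C
  G := K.G
  Bl := 0
  η := K.η
  μ := K.μ
  s₁ := 0
  s₂ := 0

/-- The dq state `(v_dc, i_d, i_q, v_d, v_q)` of a nominal-frame state: `i_dq = R(γ)ᵀ i`, `v_dq = R(γ)ᵀ v` with
`R(γ)ᵀ = [[cos γ, sin γ], [−sin γ, cos γ]]`. [cite: ArghirJouiniDorfler2018, (2)] -/
def dqState (γ vdc i₁ i₂ v₁ v₂ : ℝ) : MatchingDQ.State :=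
  ![vdc, cos γ * i₁ + sin γ * i₂, -sin γ * i₁ + cos γ * i₂, cos γ * v₁ + sin γ * v₂, -sin γ * v₁ + cos γ * v₂]

/-- The rotated load current `R(γ)ᵀ i_net` as the dq load-port input (dc port closed). -/
def dqPort (γ inet₁ inet₂ : ℝ) : ℝ × ℝ × ℝ :=
  (0, cos γ * inet₁ + sin γ * inet₂, -sin γ * inet₁ + cos γ * inet₂)

variable {K}

/-- **Change of frame (kernel).** Under the matching relation `ω* = η v_dc*` and `L, C, C_dc ≠ 0`: along every curve
satisfying the six component equations of `InverterVSM.Matching` at `t` (input `i_net(t)`), every dq component has at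
`t` the derivative given by `MatchingDQ.fieldPort` of `toDQ` with port input `dqPort` — i.e. the rotated curve solves
Arghir–Jouini–Dörfler's (10a)–(10c) with the load port open. -/
theorem hasDerivAt_dqState (hmatch : K.ωn = K.η * K.vdcRef) (hL : K.L ≠ 0) (hC : K.C ≠ 0) (hCdc : K.Cdc ≠ 0)
    {γ vdc i₁ i₂ v₁ v₂ inet₁ inet₂ : ℝ → ℝ} {t : ℝ}
    (hγ : HasDerivAt γ (K.dγ (vdc t)) t)
    (hvdc : HasDerivAt vdc (K.dvdc (γ t) (vdc t) (i₁ t) (i₂ t)) t)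
    (hi₁ : HasDerivAt i₁ (K.di₁ (γ t) (vdc t) (i₁ t) (i₂ t) (v₁ t)) t)
    (hi₂ : HasDerivAt i₂ (K.di₂ (γ t) (vdc t) (i₁ t) (i₂ t) (v₂ t)) t)
    (hv₁ : HasDerivAt v₁ (K.dv₁ (i₁ t) (v₁ t) (v₂ t) (inet₁ t)) t)
    (hv₂ : HasDerivAt v₂ (K.dv₂ (i₂ t) (v₁ t) (v₂ t) (inet₂ t)) t) (k : Fin 5) :
    HasDerivAt (fun τ => dqState (γ τ) (vdc τ) (i₁ τ) (i₂ τ) (v₁ τ) (v₂ τ) k)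
      (K.toDQ.fieldPort (dqPort (γ t) (inet₁ t) (inet₂ t))
        (dqState (γ t) (vdc t) (i₁ t) (i₂ t) (v₁ t) (v₂ t)) k) t := by
  have hs := hγ.sin
  have hc := hγ.cos
  have P := sin_sq_add_cos_sq (γ t)
  fin_cases k
  · -- v_dc
    refine hvdc.congr_deriv ?_
    simp [dqState, dqPort, toDQ, MatchingDQ.fieldPort, MatchingDQ.rhsPort, MatchingDQ.rhs, MatchingDQ.coef, dvdc]
    field_simp
    ring
  · -- i_d
    refine ((hc.mul hi₁).add (hs.mul hi₂)).congr_deriv ?_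
    simp [dqState, dqPort, toDQ, MatchingDQ.fieldPort, MatchingDQ.rhsPort, MatchingDQ.rhs, MatchingDQ.coef, dγ, di₁,
      di₂, hmatch]
    field_simp
    ring
  · -- i_q
    refine ((hs.neg.mul hi₁).add (hc.mul hi₂)).congr_deriv ?_
    simp [dqState, dqPort, toDQ, MatchingDQ.fieldPort, MatchingDQ.rhsPort, MatchingDQ.rhs, MatchingDQ.coef, dγ, di₁,
      di₂, hmatch]
    field_simp
    linear_combination (K.μ * vdc t) * P
  · -- v_d
    refine ((hc.mul hv₁).add (hs.mul hv₂)).congr_deriv ?_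
    simp [dqState, dqPort, toDQ, MatchingDQ.fieldPort, MatchingDQ.rhsPort, MatchingDQ.rhs, MatchingDQ.coef, dγ, dv₁,
      dv₂, hmatch]
    field_simp
    ring
  · -- v_q
    refine ((hs.neg.mul hv₁).add (hc.mul hv₂)).congr_deriv ?_
    simp [dqState, dqPort, toDQ, MatchingDQ.fieldPort, MatchingDQ.rhsPort, MatchingDQ.rhs, MatchingDQ.coef, dγ, dv₁,
      dv₂, hmatch]
    field_simp
    ring

end Summit.Ventures.GridStability.Models.InverterVSM.Matching

end
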